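import Summits.Ventures.YMGap.RobustBall.TorusDoorVariance
import Summits.Ventures.YMGap.RobustBall.TorusRowsSU2
import Summits.Ventures.YMGap.Thresholds.OneLinkVarianceBoundSU2
import HarnessLib

/-!
# Venture YMGap, track ROBUST-BALL (Y2) — `SU(2)`, `d = 4` torus clustering ROWS on the variance door (lineage B:
`(c, v) = (2/3, 2)` up to `β_W ≤ 1/5`)

HONEST FRAMING. WHAT THIS IS: a venture file (cell `pub-ymgap`, track Y2 ROBUST-BALL, seat ds-2): CERTIFIED torus
clustering rows for `SU(2)`, `d = 4` through the VARIANCE-form robust torus door (`TorusDoorVariance`) with the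
hypothesis-free one-link pair `c = 2/3` (sharp Haar Poincaré constant, every radius: `oneLinkPoincareSUN_two_sharp`) and
`v = 2` on the radius `3β_W/2 ≤ 3/10` (engine-2's `oneLinkVarianceBound_two_of_le_fifth`), i.e. rb-p1's `ℤ⁴` lineage B
ON THE TORUS: row value `ρ_B(β_W, ε) = e^{2ε} √(4/3) (9/2) β_W + e^{ε} √(2/3) ε = 3√3 β_W e^{2ε} + √(2/3) ε e^{ε}`
(one-parameter ball `ε₀ = 2ε`, `ε₁ = ε`), certified `< 1` in the kernel at `(β_W, ε) = (1/8, 143/1000)`,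
`(1/6, 49/1000)`, `(1/10, 209/1000)` — rb-p1's lineage B / rb-ref digits. At `β_W = 1/8` this BEATS the quarter
door's `13/100` (`TorusRowsSU2`): the torus headline candidate becomes `(1/8, 0.143)`. Each row: every member of
`ClusterDomainFR (2ε) ε r` on every torus `(ℤ/L)⁴`, `L ≥ 3`, clusters under its own perturbed measure with constant `16`
and rate `−log ρ_B/(r ⊔ 1) > 0`; HYPOTHESIS-FREE.
WHAT THIS IS NOT: no `ℤ^4`/DLR statement (rb-p1's `RowsSU2`), no area law; strong-coupling lattice rows only — no
continuum, no Millennium claim.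

## References
* rb-p1, `HOME/rb/certs/SU2-Z4-SINGLELINK-ROWS-rbp1.md` (lineage B); rb-ref `LINEAGE-R.md`; rb-theory `rb_rows.md` (VgapB).
* H. Föllmer, LNM 1362 (1988), Ch. I; R. Holley, D. Stroock, J. Stat. Phys. 46 (1987) 1159.
-/

noncomputable section

open MeasureTheory ProbabilityTheory Finset Function Real
open Literature.Probability.LatticeModels Literature.Probability.LatticeModels.DobrushinMetric
open Literature.MathematicalPhysics.QuantumLattice hiding torusNorm
open Literature.MathematicalPhysics.QuantumFieldTheory hiding ZdEdge
open Literature.MathematicalPhysics.QuantumFieldTheory.Balaban1983to89.StrongCouplingTorusWindow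
open Summit.QuantumFields.BalabanUV.InfraRed.StrongCouplingPoincareDoorSUN (OneLinkPoincareSUN oneLinkPoincareSUN_two_sharp)
open Summit.QuantumFields.BalabanUV.InfraRed.StrongCouplingVarianceDoorSUN (OneLinkVarianceBound)

namespace Summit.Ventures.YMGap.RobustBall

/-! ### Numerical bounds -/

/-- `e^{143/500} ≤ 1.331095`. [folklore] -/
theorem exp_286_le : Real.exp (143 / 500) ≤ 1.331095 := by
  have h := Real.exp_bound' (x := 143 / 500) (by norm_num) (by norm_num) (n := 5) (by norm_num)
  refine h.trans ?_
  simp only [Finset.sum_range_succ, Finset.sum_range_zero, Nat.factorial]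
  norm_num

/-- `e^{143/1000} ≤ 1.15373`. [folklore] -/
theorem exp_143_le : Real.exp (143 / 1000) ≤ 1.15373 := by
  have h := Real.exp_bound' (x := 143 / 1000) (by norm_num) (by norm_num) (n := 5) (by norm_num)
  refine h.trans ?_
  simp only [Finset.sum_range_succ, Finset.sum_range_zero, Nat.factorial]
  norm_num

/-- `e^{49/500} ≤ 1.102963`. [folklore] -/
theorem exp_098_le : Real.exp (49 / 500) ≤ 1.102963 := by
  have h := Real.exp_bound' (x := 49 / 500) (by norm_num) (by norm_num) (n := 5) (by norm_num)
  refine h.trans ?_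
  simp only [Finset.sum_range_succ, Finset.sum_range_zero, Nat.factorial]
  norm_num

/-- `e^{49/1000} ≤ 1.050221`. [folklore] -/
theorem exp_049_le : Real.exp (49 / 1000) ≤ 1.050221 := by
  have h := Real.exp_bound' (x := 49 / 1000) (by norm_num) (by norm_num) (n := 5) (by norm_num)
  refine h.trans ?_
  simp only [Finset.sum_range_succ, Finset.sum_range_zero, Nat.factorial]
  norm_num

/-- `e^{209/500} ≤ 1.518935`. [folklore] -/
theorem exp_418_le : Real.exp (209 / 500) ≤ 1.518935 := by
  have h := Real.exp_bound' (x := 209 / 500) (by norm_num) (by norm_num) (n := 5) (by norm_num)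
  refine h.trans ?_
  simp only [Finset.sum_range_succ, Finset.sum_range_zero, Nat.factorial]
  norm_num

/-- `e^{209/1000} ≤ 1.232446`. [folklore] -/
theorem exp_209_le : Real.exp (209 / 1000) ≤ 1.232446 := by
  have h := Real.exp_bound' (x := 209 / 1000) (by norm_num) (by norm_num) (n := 5) (by norm_num)
  refine h.trans ?_
  simp only [Finset.sum_range_succ, Finset.sum_range_zero, Nat.factorial]
  norm_num

/-- `√(4/3) ≤ 1.154701`. [folklore] -/
theorem sqrt_four_thirds_le : Real.sqrt (4 / 3) ≤ 1.154701 := by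
  rw [show (1.154701 : ℝ) = Real.sqrt (1.154701 ^ 2) by rw [Real.sqrt_sq (by norm_num)]]
  exact Real.sqrt_le_sqrt (by norm_num)

/-- `√(2/3) ≤ 0.816497`. [folklore] -/
theorem sqrt_twoThirds_le_fine : Real.sqrt (2 / 3) ≤ 0.816497 := by
  rw [show (0.816497 : ℝ) = Real.sqrt (0.816497 ^ 2) by rw [Real.sqrt_sq (by norm_num)]]
  exact Real.sqrt_le_sqrt (by norm_num)

/-- The lineage-B row value is monotone in the numerical majorants: for `e^{2ε} ≤ E₂`, `e^{ε} ≤ E₁`, `√(4/3) ≤ S₁`,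
`√(2/3) ≤ S₂` and `β_W, ε ≥ 0`, `ρ_B(β_W, ε) ≤ E₂ S₁ (9/2) β_W + E₁ S₂ ε`. [folklore] -/
theorem rhoB_le_of_bounds {βW ε E₂ E₁ S₁ S₂ : ℝ} (hβ : 0 ≤ βW) (hε : 0 ≤ ε) (hE₂ : Real.exp (2 * ε) ≤ E₂)
    (hE₁ : Real.exp (2 * ε / 2) ≤ E₁) (hS₁ : Real.sqrt (2 / 3 * 2) ≤ S₁) (hS₂ : Real.sqrt (2 / 3) ≤ S₂) :
    Real.exp (2 * ε) * Real.sqrt (2 / 3 * 2) * (9 / 2 * βW) + Real.exp (2 * ε / 2) * Real.sqrt (2 / 3) * ε ≤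
      E₂ * S₁ * (9 / 2 * βW) + E₁ * S₂ * ε := by
  have hE₂0 : 0 ≤ E₂ := (Real.exp_pos _).le.trans hE₂
  have hE₁0 : 0 ≤ E₁ := (Real.exp_pos _).le.trans hE₁
  refine add_le_add ?_ ?_
  · exact mul_le_mul_of_nonneg_right
      (mul_le_mul hE₂ hS₁ (Real.sqrt_nonneg _) hE₂0) (by positivity)
  · exact mul_le_mul_of_nonneg_right (mul_le_mul hE₁ hS₂ (Real.sqrt_nonneg _) hE₁0) hε

/-! ### The generic `SU(2)` lineage-B currency and the certified rows -/

/-- **The variance-door torus clustering currency for `SU(2)`, `d = 4`, `0 < β_W ≤ 1/5`** (tree coupling `β_W/2`,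
one-parameter ball `ε₀ = 2ε`, `ε₁ = ε`): if `ρ_B = e^{2ε} √(4/3) (9/2) β_W + e^{ε} √(2/3) ε < 1` then every member of
`ClusterDomainFR (2ε) ε r` clusters on every torus `L ≥ 3` with constant `16` and rate `−log ρ_B/(r ⊔ 1)`. [folklore] -/
theorem su2_torusClusteringOnBall_variance {βW ε : ℝ} (hβ0 : 0 < βW) (hβ : βW ≤ 1 / 5) (hε : 0 ≤ ε) (r : ℕ)
    (hρ1 : Real.exp (2 * ε) * Real.sqrt (2 / 3 * 2) * (9 / 2 * βW) + Real.exp (2 * ε / 2) * Real.sqrt (2 / 3) * ε < 1) :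
    TorusClusteringOnBall 2 4 (βW / 2) (2 * ε) ε r 16
      (-Real.log (Real.exp (2 * ε) * Real.sqrt (2 / 3 * 2) * (9 / 2 * βW) +
          Real.exp (2 * ε / 2) * Real.sqrt (2 / 3) * ε) / max r 1) := by
  have hP : OneLinkPoincareSUN 2 (3 * βW / 2) (2 / 3) := oneLinkPoincareSUN_two_sharp _
  have hVB : OneLinkVarianceBound 2 (3 * βW / 2) 2 := OneLinkVarianceBoundSU2.oneLinkVarianceBound_two_of_le_fifth hβ
  have hR : |βW / 2| / ((2 : ℕ) : ℝ) * (2 * (((4 : ℕ) : ℝ) - 1)) ≤ 3 * βW / 2 := by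
    rw [abs_of_pos (by positivity)]
    push_cast
    linarith
  have hcW : |βW / 2| / ((2 : ℕ) : ℝ) * (6 * (((4 : ℕ) : ℝ) - 1)) = 9 / 2 * βW := by
    rw [abs_of_pos (by positivity)]
    push_cast
    ring
  have hρ0 : 0 < Real.exp (2 * ε) * Real.sqrt (2 / 3 * 2) * (9 / 2 * βW) +
      Real.exp (2 * ε / 2) * Real.sqrt (2 / 3) * ε := by
    have h1 : 0 < Real.sqrt (2 / 3 * 2) := Real.sqrt_pos.2 (by norm_num)
    have : 0 < Real.exp (2 * ε) * Real.sqrt (2 / 3 * 2) * (9 / 2 * βW) := by positivity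
    have : 0 ≤ Real.exp (2 * ε / 2) * Real.sqrt (2 / 3) * ε := by positivity
    linarith
  have h := torusClusteringOnBall_of_poincare_of_varianceBound (d := 4) (N := 2) (by norm_num) (by norm_num)
    (β := βW / 2) (ε₀ := 2 * ε) (ε₁ := ε) (by norm_num) (by norm_num) hR hP hVB r
    (by rw [mul_assoc (Real.exp (2 * ε) * Real.sqrt (2 / 3 * 2)), hcW]; exact hρ0)
    (by rw [mul_assoc (Real.exp (2 * ε) * Real.sqrt (2 / 3 * 2)), hcW]; exact hρ1)
  have h16 : (8 : ℝ) * ((2 : ℕ) : ℝ) = 16 := by norm_num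
  rw [mul_assoc (Real.exp (2 * ε) * Real.sqrt (2 / 3 * 2)), hcW, h16] at h
  exact h

/-- Row B `(β_W, ε) = (1/8, 143/1000)`: `ρ_B < 1` (`≈ 0.9993`). [folklore] -/
theorem rhoB_oneEighth_lt_one :
    Real.exp (2 * (143 / 1000)) * Real.sqrt (2 / 3 * 2) * (9 / 2 * (1 / 8)) +
      Real.exp (2 * (143 / 1000) / 2) * Real.sqrt (2 / 3) * (143 / 1000) < (1 : ℝ) := by
  have hE₂ : Real.exp (2 * (143 / 1000)) ≤ 1.331095 := by rw [show (2 : ℝ) * (143 / 1000) = 143 / 500 by norm_num]; exact exp_286_le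
  have hE₁ : Real.exp (2 * (143 / 1000) / 2) ≤ 1.15373 := by
    rw [show (2 : ℝ) * (143 / 1000) / 2 = 143 / 1000 by norm_num]; exact exp_143_le
  have hS₁ : Real.sqrt (2 / 3 * 2) ≤ 1.154701 := by rw [show (2 : ℝ) / 3 * 2 = 4 / 3 by norm_num]; exact sqrt_four_thirds_le
  refine lt_of_le_of_lt (rhoB_le_of_bounds (by norm_num) (by norm_num) hE₂ hE₁ hS₁ sqrt_twoThirds_le_fine) ?_
  norm_num

/-- Row B `(β_W, ε) = (1/6, 49/1000)`: `ρ_B < 1` (`≈ 0.9972`). [folklore] -/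
theorem rhoB_oneSixth_lt_one :
    Real.exp (2 * (49 / 1000)) * Real.sqrt (2 / 3 * 2) * (9 / 2 * (1 / 6)) +
      Real.exp (2 * (49 / 1000) / 2) * Real.sqrt (2 / 3) * (49 / 1000) < (1 : ℝ) := by
  have hE₂ : Real.exp (2 * (49 / 1000)) ≤ 1.102963 := by rw [show (2 : ℝ) * (49 / 1000) = 49 / 500 by norm_num]; exact exp_098_le
  have hE₁ : Real.exp (2 * (49 / 1000) / 2) ≤ 1.050221 := by
    rw [show (2 : ℝ) * (49 / 1000) / 2 = 49 / 1000 by norm_num]; exact exp_049_le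
  have hS₁ : Real.sqrt (2 / 3 * 2) ≤ 1.154701 := by rw [show (2 : ℝ) / 3 * 2 = 4 / 3 by norm_num]; exact sqrt_four_thirds_le
  refine lt_of_le_of_lt (rhoB_le_of_bounds (by norm_num) (by norm_num) hE₂ hE₁ hS₁ sqrt_twoThirds_le_fine) ?_
  norm_num

/-- Row B `(β_W, ε) = (1/10, 209/1000)`: `ρ_B < 1` (`≈ 0.9996`). [folklore] -/
theorem rhoB_oneTenth_lt_one :
    Real.exp (2 * (209 / 1000)) * Real.sqrt (2 / 3 * 2) * (9 / 2 * (1 / 10)) +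
      Real.exp (2 * (209 / 1000) / 2) * Real.sqrt (2 / 3) * (209 / 1000) < (1 : ℝ) := by
  have hE₂ : Real.exp (2 * (209 / 1000)) ≤ 1.518935 := by rw [show (2 : ℝ) * (209 / 1000) = 209 / 500 by norm_num]; exact exp_418_le
  have hE₁ : Real.exp (2 * (209 / 1000) / 2) ≤ 1.232446 := by
    rw [show (2 : ℝ) * (209 / 1000) / 2 = 209 / 1000 by norm_num]; exact exp_209_le
  have hS₁ : Real.sqrt (2 / 3 * 2) ≤ 1.154701 := by rw [show (2 : ℝ) / 3 * 2 = 4 / 3 by norm_num]; exact sqrt_four_thirds_le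
  refine lt_of_le_of_lt (rhoB_le_of_bounds (by norm_num) (by norm_num) hE₂ hE₁ hS₁ sqrt_twoThirds_le_fine) ?_
  norm_num

/-- **ROW B `(β_W, ε) = (1/8, 143/1000)` — the torus headline candidate at `β_W = 1/8`**: every member of
`ClusterDomainFR (143/500) (143/1000) r` on every torus `(ℤ/L)⁴`, `L ≥ 3`, clusters at tree coupling `1/16` with constant
`16` and rate `−log ρ_B/(r ⊔ 1) > 0`; HYPOTHESIS-FREE. [folklore] -/
theorem su2_torusClusteringOnBall_oneEighth_variance (r : ℕ) :
    TorusClusteringOnBall 2 4 (1 / 16) (143 / 500) (143 / 1000) r 16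
      (-Real.log (Real.exp (2 * (143 / 1000)) * Real.sqrt (2 / 3 * 2) * (9 / 2 * (1 / 8)) +
          Real.exp (2 * (143 / 1000) / 2) * Real.sqrt (2 / 3) * (143 / 1000)) / max r 1) := by
  have e1 : (1 : ℝ) / 8 / 2 = 1 / 16 := by norm_num
  have e2 : (2 : ℝ) * (143 / 1000) = 143 / 500 := by norm_num
  have h := su2_torusClusteringOnBall_variance (βW := 1 / 8) (ε := 143 / 1000) (by norm_num) (by norm_num)
    (by norm_num) r rhoB_oneEighth_lt_one
  rw [e1] at h
  simpa only [e2] using h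

/-- **ROW B `(β_W, ε) = (1/6, 49/1000)`** (tree coupling `1/12`); HYPOTHESIS-FREE. [folklore] -/
theorem su2_torusClusteringOnBall_oneSixth_variance (r : ℕ) :
    TorusClusteringOnBall 2 4 (1 / 12) (49 / 500) (49 / 1000) r 16
      (-Real.log (Real.exp (2 * (49 / 1000)) * Real.sqrt (2 / 3 * 2) * (9 / 2 * (1 / 6)) +
          Real.exp (2 * (49 / 1000) / 2) * Real.sqrt (2 / 3) * (49 / 1000)) / max r 1) := by
  have e1 : (1 : ℝ) / 6 / 2 = 1 / 12 := by norm_num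
  have e2 : (2 : ℝ) * (49 / 1000) = 49 / 500 := by norm_num
  have h := su2_torusClusteringOnBall_variance (βW := 1 / 6) (ε := 49 / 1000) (by norm_num) (by norm_num)
    (by norm_num) r rhoB_oneSixth_lt_one
  rw [e1] at h
  simpa only [e2] using h

/-- **ROW B `(β_W, ε) = (1/10, 209/1000)`** (tree coupling `1/20`); HYPOTHESIS-FREE. [folklore] -/
theorem su2_torusClusteringOnBall_oneTenth_variance (r : ℕ) :
    TorusClusteringOnBall 2 4 (1 / 20) (209 / 500) (209 / 1000) r 16
      (-Real.log (Real.exp (2 * (209 / 1000)) * Real.sqrt (2 / 3 * 2) * (9 / 2 * (1 / 10)) +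
          Real.exp (2 * (209 / 1000) / 2) * Real.sqrt (2 / 3) * (209 / 1000)) / max r 1) := by
  have e1 : (1 : ℝ) / 10 / 2 = 1 / 20 := by norm_num
  have e2 : (2 : ℝ) * (209 / 1000) = 209 / 500 := by norm_num
  have h := su2_torusClusteringOnBall_variance (βW := 1 / 10) (ε := 209 / 1000) (by norm_num) (by norm_num)
    (by norm_num) r rhoB_oneTenth_lt_one
  rw [e1] at h
  simpa only [e2] using h

/-- The rate of row B `(1/8, 143/1000)` is positive (`ρ_B < 1`), so it inhabits the `∃ A m, 0 < m ∧ …` shape of the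
Targets rows at the LARGER radius `143/1000 ⊃ 13/100 ⊃ 97/1000`. [folklore] -/
theorem su2_exists_torusClusteringOnBall_oneEighth_variance :
    ∃ A m : ℝ, 0 < m ∧ TorusClusteringOnBall 2 4 (1 / 16) (143 / 500) (143 / 1000) 2 A m := by
  refine ⟨16, _, ?_, su2_torusClusteringOnBall_oneEighth_variance 2⟩
  have hρ0 : 0 < Real.exp (2 * (143 / 1000)) * Real.sqrt (2 / 3 * 2) * (9 / 2 * (1 / 8)) +
      Real.exp (2 * (143 / 1000) / 2) * Real.sqrt (2 / 3) * (143 / 1000 : ℝ) := by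
    have h1 : 0 < Real.sqrt (2 / 3 * 2 : ℝ) := Real.sqrt_pos.2 (by norm_num)
    have : 0 < Real.exp (2 * (143 / 1000)) * Real.sqrt (2 / 3 * 2) * (9 / 2 * (1 / 8) : ℝ) := by positivity
    have : 0 ≤ Real.exp (2 * (143 / 1000) / 2) * Real.sqrt (2 / 3) * (143 / 1000 : ℝ) := by positivity
    linarith
  exact div_pos (neg_pos.2 (Real.log_neg hρ0 rhoB_oneEighth_lt_one)) (Nat.cast_pos.2 (by norm_num))

end Summit.Ventures.YMGap.RobustBall

end
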